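import Literature.NumberTheory.LFunctions.Zhang2022.Section7SjPolylog
import Literature.NumberTheory.Sieve.ShiuDivisorClass
import HarnessLib

/-!
# Zhang (2022) §7/§11: short-interval sums of the majorant `gC` of `ξ₀ⱼ(n;d,r)` (Shiu packaging)

Topic `Literature/NumberTheory/LFunctions/Zhang2022` (Landau–Siegel audit tree; verdict-neutral).
Y. Zhang, *Discrete mean estimates and the Landau–Siegel zero*, arXiv:2211.02515v1 (2022)
[Zhang2022LandauSiegel], §7 p. 33 (the arithmetic sums `S_j(𝐚₁,𝐚₂)` of Proposition 7.1 with the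
coefficients `ξ₀ⱼ(n;d,r)`) and §11 p. 64 (the window mean squares "by (11.3), (8.25) and (8.26)",
tex L3299; DAG nodes `Z22:§11.u019`, `Z22:§11.u021`) — **an unrefereed manuscript under
adjudication; nothing here asserts or denies its Theorems 1–2.**

THEOREMS ONLY (no definition, no new claim). The tree's multiplicative majorant
`gC = Λc · (w ∗ Kmaj)` of `|ξ₀ⱼ(·;d,r)|` (`Section7SjPolylog`: `norm_xiZero_le_gC`, `gC ≥ 0`,
multiplicative, `gC(p^ν) ≤ 7(2+S₃)(ν+1)⁴`) lies in the divisor class of the tree's Shiu corollary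
`Sieve.ShiuDivisorClass.shiu_divisor_class`, UNIFORMLY in `c′` and `D`. Hence, for any prime bound
`gC(p) ≤ a + K log p + M/p` (`p ≤ x`) one is given:

* `gC_shortInterval` — `∑_{x < n ≤ x+y} gC(n) ≤ C · e^{K log(4x)+M} · y (log x)^a / log x` for
  `x ≥ x₀`, `x^{1/4} ≤ y ≤ x`, with `C, x₀` depending on `a` ONLY (not on `c′, D, K, M`);
* `gC_shortLogMean`, `gC_shortLogMean_Ioc` — the logarithmic form over a block `x < n ≤ x'`,
  `x + x^{1/4} ≤ x' ≤ 2x`: `∑ gC(n)/n ≤ C e^{K log(4x)+M} ((x'−x)/x)(log x)^a/log x`;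
* `gC_shortInterval_five` — the unconditional instance with the tree's crude prime bound
  `gC(p) ≤ 5 + (60+7M₀)/p` (`gC_prime_le`; exponent `a = 5`, `K = 0`).

With the sharper prime bound `gC(p) ≤ 3 + K_D log p + M₁/p` (`K_D = O(|b₁|+|b₂|+|b₃|)`, from
`MeanSquareMajorant.norm_kappa_prime_le`) the exponent is `a = 3` and `e^{K_D log 4x} = O(1)` on
`x ≤ P²` — the input the §11 window-`S_j` bound (leaves `Step11u019`, `Step11u019J2`) consumes.
No statement about the manuscript's Theorems 1–2 or about Landau–Siegel zeros is made or implied.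

## References

* Y. Zhang, arXiv:2211.02515v1 (2022), §7 p. 33 (Prop. 7.1), §11 p. 64.
  [cite: Zhang2022LandauSiegel, §7 Prop. 7.1 p.33; §11 p.64]
* P. Shiu, J. reine angew. Math. 313 (1980), 161–170, Theorem 1. [cite: Shiu1980, Theorem 1]
-/

noncomputable section

open Finset Real ArithmeticFunction

namespace Literature.NumberTheory.LFunctions.Zhang2022.XiZeroMajorant

open Literature.NumberTheory.Sieve

/-- **Short-interval sums of `gC` (Shiu, divisor class, uniformly in `c′, D`).** For every
`a : ℕ` there are `C ≥ 0`, `x₀ ≥ 2` such that for all `c′`, `D`, all `K, M ≥ 0`, all `x ≥ x₀`,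
`x^{1/4} ≤ y ≤ x` with `gC(p) ≤ a + K log p + M/p` for the primes `p ≤ x`:
`∑_{x < n ≤ x+y} gC(n) ≤ C · exp(K log(4x) + M) · y · (log x)^a / log x`.
[cite: Zhang2022LandauSiegel, §7 Prop. 7.1 p.33] -/
theorem gC_shortInterval (a : ℕ) :
    ∃ C x₀ : ℝ, 0 ≤ C ∧ 2 ≤ x₀ ∧ ∀ (c' : ℝ) (D : ℕ) (K M : ℝ), 0 ≤ K → 0 ≤ M →
      ∀ x y : ℝ, x₀ ≤ x → x ^ (1 / 4 : ℝ) ≤ y → y ≤ x →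
        (∀ p : ℕ, p.Prime → (p : ℝ) ≤ x → gC c' D p ≤ a + K * Real.log p + M / p) →
        ∑ n ∈ (Finset.Icc 1 ⌊x + y⌋₊).filter (fun n : ℕ => x < n), gC c' D n ≤
          C * Real.exp (K * Real.log (4 * x) + M) * y * Real.log x ^ a / Real.log x := by
  obtain ⟨C, x₀, hC0, hx₀, h⟩ :=
    ShiuDivisorClass.shiu_divisor_class a 4 (7 * (2 + LogEulerProduct.tailConst 3))
  refine ⟨C, x₀, hC0, hx₀, fun c' D K M hK hM x y hx hxy hyx hfp => ?_⟩
  exact h (fun n => gC c' D n) (gC_nonneg c' D)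
    (fun m n hmn => (isMultiplicative_gC c' D).map_mul_of_coprime hmn)
    (fun p ν hp _ => gC_prime_pow_le c' D hp ν) K M hK hM x y hx hxy hyx hfp

/-- **Short logarithmic means of `gC`**: with `C, x₀` depending on `a` only, for `x ≥ x₀`,
`x + x^{1/4} ≤ x' ≤ 2x` and `gC(p) ≤ a + K log p + M/p` (`p ≤ x`):
`∑_{x < n ≤ x'} gC(n)/n ≤ C · exp(K log(4x) + M) · ((x' − x)/x) · (log x)^a / log x`.
[cite: Zhang2022LandauSiegel, §7 Prop. 7.1 p.33] -/
theorem gC_shortLogMean (a : ℕ) :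
    ∃ C x₀ : ℝ, 0 ≤ C ∧ 2 ≤ x₀ ∧ ∀ (c' : ℝ) (D : ℕ) (K M : ℝ), 0 ≤ K → 0 ≤ M →
      ∀ x x' : ℝ, x₀ ≤ x → x + x ^ (1 / 4 : ℝ) ≤ x' → x' ≤ 2 * x →
        (∀ p : ℕ, p.Prime → (p : ℝ) ≤ x → gC c' D p ≤ a + K * Real.log p + M / p) →
        ∑ n ∈ (Finset.Icc 1 ⌊x'⌋₊).filter (fun n : ℕ => x < n), gC c' D n / n ≤
          C * Real.exp (K * Real.log (4 * x) + M) * ((x' - x) / x) * Real.log x ^ a /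
            Real.log x := by
  obtain ⟨C, x₀, hC0, hx₀, h⟩ :=
    ShiuDivisorClass.shiu_divisor_class_logMean a 4 (7 * (2 + LogEulerProduct.tailConst 3))
  refine ⟨C, x₀, hC0, hx₀, fun c' D K M hK hM x x' hx hxx' hx'x hfp => ?_⟩
  exact h (fun n => gC c' D n) (gC_nonneg c' D)
    (fun m n hmn => (isMultiplicative_gC c' D).map_mul_of_coprime hmn)
    (fun p ν hp _ => gC_prime_pow_le c' D hp ν) K M hK hM x x' hx hxx' hx'x hfp

/-- **Short logarithmic means of `gC` over `Finset.Ioc ⌊x⌋₊ ⌊x'⌋₊`** (same statement as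
`gC_shortLogMean`). [cite: Zhang2022LandauSiegel, §7 Prop. 7.1 p.33] -/
theorem gC_shortLogMean_Ioc (a : ℕ) :
    ∃ C x₀ : ℝ, 0 ≤ C ∧ 2 ≤ x₀ ∧ ∀ (c' : ℝ) (D : ℕ) (K M : ℝ), 0 ≤ K → 0 ≤ M →
      ∀ x x' : ℝ, x₀ ≤ x → x + x ^ (1 / 4 : ℝ) ≤ x' → x' ≤ 2 * x →
        (∀ p : ℕ, p.Prime → (p : ℝ) ≤ x → gC c' D p ≤ a + K * Real.log p + M / p) →
        ∑ n ∈ Finset.Ioc ⌊x⌋₊ ⌊x'⌋₊, gC c' D n / n ≤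
          C * Real.exp (K * Real.log (4 * x) + M) * ((x' - x) / x) * Real.log x ^ a /
            Real.log x := by
  obtain ⟨C, x₀, hC0, hx₀, h⟩ :=
    ShiuDivisorClass.shiu_divisor_class_logMean_Ioc a 4 (7 * (2 + LogEulerProduct.tailConst 3))
  refine ⟨C, x₀, hC0, hx₀, fun c' D K M hK hM x x' hx hxx' hx'x hfp => ?_⟩
  exact h (fun n => gC c' D n) (gC_nonneg c' D)
    (fun m n hmn => (isMultiplicative_gC c' D).map_mul_of_coprime hmn)
    (fun p ν hp _ => gC_prime_pow_le c' D hp ν) K M hK hM x x' hx hxx' hx'x hfp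

/-- **The unconditional instance** (crude prime bound `gC(p) ≤ 5 + (60+7M₀)/p` of
`gC_prime_le`, exponent `5`): there are absolute `C ≥ 0`, `x₀ ≥ 2` with
`∑_{x < n ≤ x+y} gC(n) ≤ C · y · (log x)^5 / log x` for all `c′, D`, `x ≥ x₀`, `x^{1/4} ≤ y ≤ x`.
[cite: Zhang2022LandauSiegel, §7 Prop. 7.1 p.33] -/
theorem gC_shortInterval_five :
    ∃ C x₀ : ℝ, 0 ≤ C ∧ 2 ≤ x₀ ∧ ∀ (c' : ℝ) (D : ℕ) (x y : ℝ), x₀ ≤ x → x ^ (1 / 4 : ℝ) ≤ y →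
      y ≤ x → ∑ n ∈ (Finset.Icc 1 ⌊x + y⌋₊).filter (fun n : ℕ => x < n), gC c' D n ≤
        C * y * Real.log x ^ 5 / Real.log x := by
  obtain ⟨C, x₀, hC0, hx₀, h⟩ := gC_shortInterval 5
  have hM0 := M0_nonneg
  refine ⟨C * Real.exp (60 + 7 * M0), x₀, by positivity, hx₀, fun c' D x y hx hxy hyx => ?_⟩
  have hfp : ∀ p : ℕ, p.Prime → (p : ℝ) ≤ x →
      gC c' D p ≤ (5 : ℕ) + 0 * Real.log p + (60 + 7 * M0) / p := by
    intro p hp _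
    have := gC_prime_le c' D hp
    push_cast
    linarith
  have key := h c' D 0 (60 + 7 * M0) le_rfl (by positivity) x y hx hxy hyx hfp
  rw [zero_mul, zero_add] at key
  calc _ ≤ C * Real.exp (60 + 7 * M0) * y * Real.log x ^ 5 / Real.log x := key
    _ = _ := by ring

end Literature.NumberTheory.LFunctions.Zhang2022.XiZeroMajorant
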